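import Literature.AnabelianGeometry.SemiGraphs.AmbientVocabOfReal

/-!
# Connectedness: the container's `IsConnected` at `SemiAnbdVocab.ofReal` is t1's `SemiGraph.IsConnected` ([SemiAnbd] §1 pp.11–12, §2 p.22)

Mochizuki, *Semi-graphs of anabelioids*, Publ. RIMS **42** (2006), §1 pp.11–12 (the topological space
associated to a semi-graph), §2 p.22 ("the underlying semi-graph is assumed to be connected")
(kurims `paper:url-f33ace170ff4`). [cite: MochizukiSemiAnbd2006, §1, p. 12]

PROOF-ONLY `_iff` bridge (L3 merge dictionary, continuing `AmbientVocabDictionary.lean`): the §§4–5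
container (`InterfaceVocab.lean`) renders "connected" as "nonempty, and any two components (vertices /
edges) are joined by a chain of incidences" (`SemiAnbdVocab.IsConnected`, via `Relation.EqvGen` of
`SemiAnbdVocab.Incident`); t1 renders it as connectedness of the barycentric subdivision
(`SemiGraph.subdivision`, a simple graph on vertices ⊔ edges ⊔ branches).  At the real term
`SemiAnbdVocab.ofReal R` the two agree: `SemiAnbdVocab.ofReal_isConnected_iff`.  The comparison goes
through the projection of the subdivision's nodes onto components (a branch-point goes to its edge;
the `Sum.elim` below) and its section (an edge goes to its midpoint; `Sum.map id Sum.inl`): a step of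
the subdivision projects to an incidence or a stutter, and an incidence `v — e` (through a branch `b`)
lifts to the 2-step path `v — b — e`.  No definitions.
-/

namespace Literature.AnabelianGeometry.SemiGraphs

open CategoryTheory

universe v₁ u₁ u

namespace SemiAnbdVocab

open SgAQuot SgAQuot.SgA

variable (R : SgA.BridgeResidual.{v₁, u₁, u})

section

variable {G : SgA.{v₁, u₁, u}}

/-- The projection (branch-point ↦ its edge) retracts the section (edge ↦ its midpoint).
[cite: MochizukiSemiAnbd2006, §1, p. 12] -/
private theorem proj_sec (x : G.toSgA.graph.Vertex ⊕ G.toSgA.graph.Edge) :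
    Sum.elim Sum.inl (Sum.elim Sum.inr fun c => Sum.inr (G.toSgA.graph.edgeOf c))
      (Sum.map id Sum.inl x : G.toSgA.graph.Node) = x := by
  cases x <;> rfl

/-- An incidence generator of the subdivision projects to an incidence of components or to a
stutter. [cite: MochizukiSemiAnbd2006, §1, p. 12] -/
private theorem eqvGen_of_nodeRel {a b : G.toSgA.graph.Node} (h : G.toSgA.graph.NodeRel a b) :
    Relation.EqvGen ((SemiAnbdVocab.ofReal R).Incident G)
      (Sum.elim Sum.inl (Sum.elim Sum.inr fun c => Sum.inr (G.toSgA.graph.edgeOf c)) a)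
      (Sum.elim Sum.inl (Sum.elim Sum.inr fun c => Sum.inr (G.toSgA.graph.edgeOf c)) b) := by
  cases h with
  | edge_branch b => exact Relation.EqvGen.refl _
  | branch_vertex b v h =>
    refine Relation.EqvGen.rel _ _ ?_
    change ∃ c : G.toSgA.graph.branchesOf (G.toSgA.graph.edgeOf b), G.toSgA.graph.abuts c.1 = some v
    exact ⟨⟨b, rfl⟩, h⟩

/-- An adjacency of the subdivision projects into the equivalence generated by incidence.
[cite: MochizukiSemiAnbd2006, §1, p. 12] -/
private theorem eqvGen_of_adj {a b : G.toSgA.graph.Node} (h : G.toSgA.graph.subdivision.Adj a b) :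
    Relation.EqvGen ((SemiAnbdVocab.ofReal R).Incident G)
      (Sum.elim Sum.inl (Sum.elim Sum.inr fun c => Sum.inr (G.toSgA.graph.edgeOf c)) a)
      (Sum.elim Sum.inl (Sum.elim Sum.inr fun c => Sum.inr (G.toSgA.graph.edgeOf c)) b) := by
  rw [SemiGraph.subdivision, SimpleGraph.fromRel_adj] at h
  rcases h.2 with h' | h'
  · exact eqvGen_of_nodeRel R h'
  · exact Relation.EqvGen.symm _ _ (eqvGen_of_nodeRel R h')

/-- Reachability in the subdivision projects into the equivalence generated by incidence.
[cite: MochizukiSemiAnbd2006, §1, p. 12] -/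
private theorem eqvGen_of_reachable {a b : G.toSgA.graph.Node}
    (h : G.toSgA.graph.subdivision.Reachable a b) :
    Relation.EqvGen ((SemiAnbdVocab.ofReal R).Incident G)
      (Sum.elim Sum.inl (Sum.elim Sum.inr fun c => Sum.inr (G.toSgA.graph.edgeOf c)) a)
      (Sum.elim Sum.inl (Sum.elim Sum.inr fun c => Sum.inr (G.toSgA.graph.edgeOf c)) b) := by
  rw [SimpleGraph.reachable_iff_reflTransGen] at h
  induction h with
  | refl => exact Relation.EqvGen.refl _
  | tail _ hbc ih => exact Relation.EqvGen.trans _ _ _ ih (eqvGen_of_adj R hbc)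

/-- Every node of the subdivision is reachable from the node of its component.
[cite: MochizukiSemiAnbd2006, §1, p. 12] -/
private theorem reachable_sec_proj (a : G.toSgA.graph.Node) :
    G.toSgA.graph.subdivision.Reachable
      (Sum.map id Sum.inl
        (Sum.elim Sum.inl (Sum.elim Sum.inr fun c => Sum.inr (G.toSgA.graph.edgeOf c)) a)) a := by
  rcases a with v | e | b
  · exact SimpleGraph.Reachable.refl _
  · exact SimpleGraph.Reachable.refl _
  · refine SimpleGraph.Adj.reachable ?_
    rw [SemiGraph.subdivision, SimpleGraph.fromRel_adj]
    exact ⟨by simp, Or.inl (SemiGraph.NodeRel.edge_branch b)⟩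

/-- An incidence of components lifts to a (2-step) path of the subdivision.
[cite: MochizukiSemiAnbd2006, §1, p. 12] -/
private theorem reachable_of_incident {x y : G.toSgA.graph.Vertex ⊕ G.toSgA.graph.Edge}
    (h : (SemiAnbdVocab.ofReal R).Incident G x y) :
    G.toSgA.graph.subdivision.Reachable (Sum.map id Sum.inl x) (Sum.map id Sum.inl y) := by
  -- the vertex–edge case, used in both orientations
  have key : ∀ (v : G.toSgA.graph.Vertex) (e : G.toSgA.graph.Edge),
      (∃ c : G.toSgA.graph.branchesOf e, G.toSgA.graph.abuts c.1 = some v) →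
        G.toSgA.graph.subdivision.Reachable (Sum.inl v) (Sum.inr (Sum.inl e)) := by
    rintro v e ⟨⟨b, hbe⟩, hbv⟩
    subst hbe
    have h₁ : G.toSgA.graph.subdivision.Adj (Sum.inl v) (Sum.inr (Sum.inr b)) := by
      rw [SemiGraph.subdivision, SimpleGraph.fromRel_adj]
      exact ⟨by simp, Or.inr (SemiGraph.NodeRel.branch_vertex b v hbv)⟩
    have h₂ : G.toSgA.graph.subdivision.Adj (Sum.inr (Sum.inr b))
        (Sum.inr (Sum.inl (G.toSgA.graph.edgeOf b))) := by
      rw [SemiGraph.subdivision, SimpleGraph.fromRel_adj]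
      exact ⟨by simp, Or.inr (SemiGraph.NodeRel.edge_branch b)⟩
    exact h₁.reachable.trans h₂.reachable
  rcases x with v | e <;> rcases y with w | f
  · exact absurd h id
  · exact key v f h
  · exact (key w e h).symm
  · exact absurd h id

/-- The equivalence generated by incidence lifts to reachability in the subdivision.
[cite: MochizukiSemiAnbd2006, §1, p. 12] -/
private theorem reachable_of_eqvGen {x y : G.toSgA.graph.Vertex ⊕ G.toSgA.graph.Edge}
    (h : Relation.EqvGen ((SemiAnbdVocab.ofReal R).Incident G) x y) :
    G.toSgA.graph.subdivision.Reachable (Sum.map id Sum.inl x) (Sum.map id Sum.inl y) := by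
  induction h with
  | rel _ _ h => exact reachable_of_incident R h
  | refl _ => exact SimpleGraph.Reachable.refl _
  | symm _ _ _ ih => exact ih.symm
  | trans _ _ _ _ _ ih₁ ih₂ => exact ih₁.trans ih₂

end

/-- **The container's "connected" at the real vocabulary is t1's `SemiGraph.IsConnected`**
(connectedness of the barycentric subdivision of the underlying semi-graph).
[cite: MochizukiSemiAnbd2006, §2, p. 22] -/
theorem ofReal_isConnected_iff (G : SgA.{v₁, u₁, u}) :
    (SemiAnbdVocab.ofReal R).IsConnected G ↔ G.toSgA.graph.IsConnected := by
  rw [SemiGraph.isConnected_iff, SimpleGraph.connected_iff]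
  change (Nonempty (G.toSgA.graph.Vertex ⊕ G.toSgA.graph.Edge) ∧
      ∀ x y : G.toSgA.graph.Vertex ⊕ G.toSgA.graph.Edge,
        Relation.EqvGen ((SemiAnbdVocab.ofReal R).Incident G) x y) ↔ _
  constructor
  · rintro ⟨⟨x₀⟩, h⟩
    refine ⟨fun a b => ?_, ⟨Sum.map id Sum.inl x₀⟩⟩
    exact ((reachable_sec_proj a).symm.trans (reachable_of_eqvGen R (h _ _))).trans
      (reachable_sec_proj b)
  · rintro ⟨h, ⟨a₀⟩⟩
    refine ⟨⟨Sum.elim Sum.inl (Sum.elim Sum.inr fun c => Sum.inr (G.toSgA.graph.edgeOf c)) a₀⟩,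
      fun x y => ?_⟩
    have := eqvGen_of_reachable R (h (Sum.map id Sum.inl x) (Sum.map id Sum.inl y))
    erw [proj_sec, proj_sec] at this
    exact this

end SemiAnbdVocab

end Literature.AnabelianGeometry.SemiGraphs
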